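import Summits.KontsevichZagierPeriods.KontsevichZagierPeriods.Theorems.SoloBlindGreenB
import HarnessLib

/-!
# Green's formula on the half-plane inside the rules, III: the route through `y` — `[D, h] ≡ [baseA, -Q(x,0)]`

For a `GreenDatum` `g` on `D = {x < ½, y > 0}`, `h = Re g' = ∂Q/∂y` (`Q = Im g`).  Integrating
first in `y` over the fibres `{x} × (0, ∞)`, `x ∈ baseA = (-∞,0) ∪ (0,½)` (the line `x = 0` is
null, rule (1)), is one Newton–Leibniz move once the fibre is compactified by `y = t/(1-t)`
(`chartA` of `SoloBlindCauchyChartA`): the fibre primitive `Q(x, y(t))` is continuous on `[0,1]`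
— at `t = 0` by the boundary continuity of `g`, at `t = 1` because `g → 0` as `y → ∞` — and
`Q(x, y(1)) - Q(x, y(0)) = -Q(x, 0)`.  Hence `[D, h] ≡ [baseA, -Q(x,0)]` (`rep_sub_edgeRep`), and
with route B (`SoloBlindGreenB`) the **Green/Cauchy identity inside the rules**

  `GreenDatum.midRep_sub_edgeRep : [(0,∞), P(½,y)] - [baseA, -Q(x,0)] ∈ relations`.

References: Kontsevich–Zagier, *Periods* (2001), §1.2 (rules (1)–(3)).
-/

noncomputable section

open Set Complex MeasureTheory Filter
open scoped Topology
open Literature.ModelTheory.ExponentialFields MvPolynomial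
open Literature.NumberTheory.Transcendental
open Literature.NumberTheory.Transcendental.KZ

namespace Summit.KontsevichZagierPeriods.KontsevichZagierPeriods.Theorems

namespace SoloBlind

namespace GreenDatum

variable (D : GreenDatum)

/-! ## The punctured surface term -/

/-- `[D_A, h]`, `D_A = D ∖ {x = 0}`. -/
def repA : IntegralRep 2 := D.rep.restrict DomA isSemialgebraic_DomA DomA_subset_Dom

/-- `[D, h] - [D_A, h]` is a relation (rule (1), the removed line is null). -/
theorem rep_sub_repA : of D.rep - of D.repA ∈ relations :=
  D.rep.of_sub_of_restrict_mem_relations isSemialgebraic_DomA DomA_subset_Dom volume_Dom_diff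

/-! ## The transported integrand and the fibre primitive -/

/-- `f_A(x,t) = h(Φ_A(x,t)) m'(t)` (`t < 1`), `0` on the edge `t = 1`. -/
def fA (w : Fin 2 → ℝ) : ℝ := if w 1 < 1 then D.H (chartA w) / (1 - w 1) ^ 2 else 0

/-- `F_A(x,t) = Q(Φ_A(x,t))` (`t < 1`), `0` on the edge `t = 1`. -/
def FA (w : Fin 2 → ℝ) : ℝ := if w 1 < 1 then D.Q (chartA w) else 0

/-- `f_A` is `ℚ`-semialgebraic on the closed band. -/
theorem sa_fA : IsSemialgebraicFunOn ℚ bandA D.fA := by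
  have h1 : IsSemialgebraicFunOn ℚ {w : Fin 2 → ℝ | w 0 ∈ baseA ∧ 0 ≤ w 1 ∧ w 1 < 1}
      (fun w => D.H (chartA w) / (1 - w 1) ^ 2) := by
    have hsa := D.sa_h.comp_isSemialgebraicMapOn_holds
      (isSemialgebraicMapOn_chartA isSemialgebraic_bandA₁ fun w hw => ne_of_lt hw.2.2)
      chartA_mapsTo
    have hq := isSemialgebraicFunOn_aeval_div_aeval isSemialgebraic_bandA₁
      (1 : MvPolynomial (Fin 2) ℚ) ((1 - X 1) ^ 2) fun w hw => by
        simpa [sub_eq_zero] using fun h => (ne_of_lt hw.2.2) h.symm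
    exact (hsa.fun_mul hq).congr fun w _ => by simp [Function.comp, H, div_eq_mul_inv]
  rw [bandA_eq_union]
  refine h1.union (isSemialgebraicFunOn_const_of_isAlgebraic isSemialgebraic_bandA₂
    isAlgebraic_zero) (fun w hw => ?_) (fun w hw => ?_)
  · exact if_pos hw.2.2
  · exact if_neg (not_lt.mpr hw.2.1)

/-- `F_A` is `ℚ`-semialgebraic on the closed band. -/
theorem sa_FA : IsSemialgebraicFunOn ℚ bandA D.FA := by
  have h1 : IsSemialgebraicFunOn ℚ {w : Fin 2 → ℝ | w 0 ∈ baseA ∧ 0 ≤ w 1 ∧ w 1 < 1}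
      (fun w => D.Q (chartA w)) :=
    (D.sa_im.comp_isSemialgebraicMapOn_holds
      (isSemialgebraicMapOn_chartA isSemialgebraic_bandA₁ fun w hw => ne_of_lt hw.2.2)
      chartA_mapsTo).congr fun w _ => by simp only [Function.comp, Q]
  rw [bandA_eq_union]
  refine h1.union (isSemialgebraicFunOn_const_of_isAlgebraic isSemialgebraic_bandA₂
    isAlgebraic_zero) (fun w hw => ?_) (fun w hw => ?_)
  · exact if_pos hw.2.2
  · exact if_neg (not_lt.mpr hw.2.1)

/-- `f_A` is absolutely integrable on the open band (transport from `[D_A, h]`). -/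
theorem integrableOn_fA : IntegrableOn D.fA openBandA := by
  have h := (integrableOn_iff_of_chart (S := openBandA) (Φ := chartA) (Φ' := chartADeriv)
    (J := fun w => 1 / (1 - w 1) ^ 2) (f := D.fA) (g := D.H)
    isOpen_openBandA.measurableSet (fun w hw => hasFDerivAt_chartA (ne_of_lt hw.2.2))
    (injOn_chartA.mono fun w hw => hw.2.2) (fun w _ => abs_det_chartADeriv w)
    (fun w hw => by simp [fA, hw.2.2, div_eq_mul_inv])).mp
  rw [image_chartA] at h
  exact h D.repA.integrableOn

/-! ## The representations and the moves -/

/-- **`[baseA × [0,1], f_A]`**, the band form of `[D_A, h]`. -/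
def bandRepA : IntegralRep 2 where
  domain := bandA
  integrand := D.fA
  isSemialgebraic_domain := isSemialgebraic_bandA
  isSemialgebraicFunOn_integrand := D.sa_fA
  integrableOn := D.integrableOn_fA.congr_set_ae
    (ae_eq_set.2 ⟨volume_bandA_diff,
      measure_mono_null (fun _ hw => hw.2 (openBandA_subset_bandA hw.1)) measure_empty⟩)

/-- **`[baseA × (0,1), f_A]`**, its restriction to the open band. -/
def openBandRepA : IntegralRep 2 :=
  D.bandRepA.restrict openBandA isSemialgebraic_openBandA openBandA_subset_bandA

/-- **Rule (3) in `t`**: `[baseA × [0,1], f_A] - [baseA, F_A(x,1) - F_A(x,0)]` is a relation,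
and `F_A(x,1) - F_A(x,0) = 0 - Q(x,0)`. -/
theorem bandRepA_sub_edgeRep : of D.bandRepA - of D.edgeRep ∈ relations := by
  have e0 : ∀ (x : Fin 1 → ℝ) (t : ℝ), (Fin.snoc x t : Fin 2 → ℝ) 0 = x 0 := fun _ _ => rfl
  have e1 : ∀ (x : Fin 1 → ℝ) (t : ℝ), (Fin.snoc x t : Fin 2 → ℝ) 1 = t := fun _ _ => rfl
  have hch : ∀ (x : Fin 1 → ℝ) (t : ℝ), chartA (Fin.snoc x t) = ![x 0, moeb t] :=
    fun x t => by funext i; fin_cases i <;> simp [chartA, e0, e1]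
  have hdom : ∀ x ∈ D.edgeRep.domain, x 0 < 1 / 2 ∧ x 0 ≠ 0 := fun x hx => by
    simpa [edgeRep, mem_line, baseA] using hx
  refine newtonLeibnizRel_subset_relations ⟨1, D.bandRepA, D.edgeRep, fun _ => 0,
    fun _ => 1, D.FA, D.sa_FA,
    isSemialgebraicFunOn_const_of_isAlgebraic D.edgeRep.isSemialgebraic_domain isAlgebraic_zero,
    isSemialgebraicFunOn_const_of_isAlgebraic D.edgeRep.isSemialgebraic_domain isAlgebraic_one,
    fun _ _ => zero_le_one, ?_, ?_, ?_, ?_, rfl⟩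
  · ext z
    simp only [bandRepA, bandA, mem_setOf_eq, edgeRep, lineRep_domain, mem_line,
      Fin.init, Fin.castSucc_zero, show (Fin.last 1 : Fin 2) = 1 from rfl]
  · intro x hx
    have hx' := hdom x hx
    have hG : ∀ t : ℝ, D.FA (Fin.snoc x t) =
        if t < 1 then (D.g ((x 0 : ℂ) + (moeb t : ℝ) * I)).im else 0 := by
      intro t
      rw [FA, e1, hch, (D.PQH_apply _ _).2.1]
    simp only [hG]
    refine continuousOn_Icc_of_tendsto ?_ (by simp) ?_
    · refine ContinuousOn.congr (f := fun t : ℝ =>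
        (D.g ((x 0 : ℂ) + (moeb t : ℝ) * I)).im) ?_ fun t ht => if_pos ht.2
      intro t ht
      have hm : ContinuousAt moeb t := (hasDerivAt_moeb (ne_of_lt ht.2)).continuousAt
      by_cases h0 : 0 < t
      · have h2 := D.continuousAt_dy (x := x 0) (y := moeb t) hx'.1.le (moeb_pos h0 ht.2)
        exact (Complex.continuous_im.continuousAt.comp
          (ContinuousAt.comp (f := moeb) h2 hm)).continuousWithinAt
      · have ht0 : t = 0 := le_antisymm (not_lt.mp h0) ht.1
        subst ht0
        have hg : ContinuousWithinAt (fun y : ℝ => D.g ((x 0 : ℂ) + y * I)) (Ici 0) (moeb 0) := by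
          rw [moeb_zero]
          exact D.cwa (x 0) hx'.1 hx'.2
        exact Complex.continuous_im.continuousAt.comp_continuousWithinAt
          (hg.comp hm.continuousWithinAt fun s hs => moeb_nonneg hs.1 hs.2)
    · have hT : Tendsto (fun t : ℝ => (D.g ((x 0 : ℂ) + (moeb t : ℝ) * I)).im)
          (𝓝[<] (1 : ℝ)) (𝓝 0) := by
        have h := (Complex.continuous_im.tendsto 0).comp
          ((D.tendsto_atTop (x 0) hx'.1).comp tendsto_moeb_one)
        simpa [Function.comp_def] using h
      refine hT.congr' ?_
      filter_upwards [self_mem_nhdsWithin] with t ht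
      rw [if_pos (mem_Iio.mp ht)]
  · intro x hx t ht
    have hx' := hdom x hx
    have hφ : HasDerivAt moeb (1 / (1 - t) ^ 2) t := hasDerivAt_moeb (ne_of_lt ht.2)
    have h2 := D.hasDerivAt_im_dy (x := x 0) (y := moeb t) hx'.1.le (moeb_pos ht.1 ht.2)
    have hcomp : HasDerivAt
        (fun s : ℝ => (D.g ((x 0 : ℂ) + (moeb s : ℝ) * I)).im)
        ((D.g' ((x 0 : ℂ) + (moeb t : ℝ) * I)).re * (1 / (1 - t) ^ 2)) t := by
      have h := HasDerivAt.comp t h2 hφ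
      exact h
    have hev : (fun s : ℝ => D.FA (Fin.snoc x s)) =ᶠ[nhds t]
        fun s : ℝ => (D.g ((x 0 : ℂ) + (moeb s : ℝ) * I)).im := by
      filter_upwards [Iio_mem_nhds ht.2] with s hs
      rw [FA, e1, if_pos (show s < 1 from hs), hch, (D.PQH_apply _ _).2.1]
    refine (hcomp.congr_of_eventuallyEq hev).congr_deriv ?_
    show _ = D.fA (Fin.snoc x t)
    rw [fA, e1, if_pos ht.2, hch, (D.PQH_apply _ _).2.2]
    ring
  · intro x hx
    simp only [edgeRep, lineRep_integrand, edge]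
    rw [FA, FA, e1, e1, if_neg (lt_irrefl _), if_pos zero_lt_one, hch, moeb_zero, zero_sub]

/-- **Rule (2) along `Φ_A`**: `[baseA × (0,1), f_A] ≡ [D_A, h]`. -/
theorem openBandRepA_equivalent : Equivalent D.openBandRepA D.repA :=
  equivalent_of_chart (f := D.fA) (g := D.H) (J := fun w => 1 / (1 - w 1) ^ 2)
    (isSemialgebraicMapOn_chartA isSemialgebraic_openBandA fun w hw => ne_of_lt hw.2.2)
    (fun w hw => hasFDerivAt_chartA (ne_of_lt hw.2.2)) (injOn_chartA.mono fun w hw => hw.2.2)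
    image_chartA (fun w _ => abs_det_chartADeriv w)
    (fun w hw => by simp [fA, hw.2.2, div_eq_mul_inv]) rfl (fun _ _ => rfl) rfl (fun _ _ => rfl)

/-- **Green's formula inside the rules, route A: `[D, h] ≡ [baseA, -Q(x,0)]`.** -/
theorem rep_sub_edgeRep : of D.rep - of D.edgeRep ∈ relations := by
  have h0 := D.rep_sub_repA
  have h1 := D.bandRepA_sub_edgeRep
  have h2 : of D.bandRepA - of D.openBandRepA ∈ relations :=
    D.bandRepA.of_sub_of_restrict_mem_relations isSemialgebraic_openBandA
      openBandA_subset_bandA volume_bandA_diff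
  have h3 : of D.openBandRepA - of D.repA ∈ relations := D.openBandRepA_equivalent
  have h := relations.add_mem (relations.sub_mem (relations.sub_mem h0 h3) h2) h1
  convert h using 1
  abel

/-- **Green's formula / Cauchy's theorem inside Kontsevich–Zagier's rules.**  For every Green
datum `g` on the half-plane `D = {x < ½, y > 0}`:

  `[(0,∞), Re g(½ + iy)] - [(-∞,0) ∪ (0,½), -Im g(x)] ∈ relations`,

the imaginary part of `∮_{∂D} g(z) dz = 0`, obtained by rules (1)–(3) only. -/
theorem midRep_sub_edgeRep : of D.midRep - of D.edgeRep ∈ relations := by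
  have h := relations.sub_mem D.rep_sub_edgeRep D.rep_sub_midRep
  convert h using 1
  abel

end GreenDatum

end SoloBlind

end Summit.KontsevichZagierPeriods.KontsevichZagierPeriods.Theorems
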